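import Summits.NavierStokesRegularity.NavierStokesRegularity.Theorems.FilamentSkeletonRssDefectColumnGateAxialDrift

/-!
# Route `FilamentSkeletonRss` · crux `TransverseReduction1AL` (stmt-NavierStokesRegularity-23297) · line `defect_column_gate_1AL` —
# THE AXIAL SOLVABILITY CONDITION: bounded profiles of `−a″ + κτ a′ = f` force `∫ e^{−κτ²/2} f = 0`

Helper file (`--supports stmt-NavierStokesRegularity-23297 --as helper`; LEAD of 23297, lane ns-filament-21221-p1 g12), companion of
`…DefectColumnGateAxialDrift.lean`.  The axial operator `T_κ a = −a″ + κτ a′` of the S2a-loc/S2b-loc model (the sectional-MASS amplitude of a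
tube is transported OUTWARD from the waist at velocity `κτ` and diffused, `colForceVort_eq` + the whole-section mass budget) has, on profiles with
BOUNDED SLOPE on the whole axis, a one-dimensional COKERNEL: the Gaussian `e^{−κτ²/2}` (`T_κ^* e^{−κτ²/2} = 0`).  Concretely:

* `gaussFactor_mul_deriv_tendsto_zero` — if `a′` is bounded then `e^{−κτ²/2} a′(τ) → 0` as `τ → ±∞` (`κ > 0`);
* **`axial_solvability_interval`** — on any `[σ, T]`: `∫_σ^T e^{−κs²/2} f(s) ds = e^{−κσ²/2} a′(σ) − e^{−κT²/2} a′(T)` (the integrating factor of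
  `axial_deriv_repr`);
* **`axial_solvability`** — if `a′ = a₁` is BOUNDED on `ℝ`, `a₁′ = a₂`, `a₂ = κ s a₁ − f` (`−a″ + κ s a′ = f`) with `f` continuous and bounded, then
  the improper integral converges and **`∫_{−∞}^{∞} e^{−κs²/2} f(s) ds = 0`**.

READING (LEAD memo S2B-ACCRETION-OBSTRUCTION-23297-g12.md): a steady forcing that feeds axial-vorticity flux into a tube at its waist with non-zero
Gaussian-weighted mean admits NO response with bounded slope — the flux grows linearly in time instead («m = 0 waveguide» of the crux's
why-might-fail); in the profile-level gate of the line this is one solvability condition PER TUBE (the waist ACCRETION functional of the retired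
`TransverseReductionRJ` design), not covered by the single rate border of `DefectGateSpec1AG`.

HONEST FRAMING: an elementary lemma about ONE linear MODEL operator of a hypothetical blow-up route (MODEL rung, negative side); no stub is proved or
refuted here; `TransverseReduction1AL` open; nothing here bears on Navier–Stokes regularity.
-/

set_option linter.dupNamespace false

noncomputable section

namespace Summit.NavierStokesRegularity.NavierStokesRegularity.Theorems.DefectColumnGate

open scoped Topology
open Set Filter MeasureTheory intervalIntegral

/-- `e^{−κτ²/2} · a₁(τ) → 0` along any filter tending to `±∞` in the sense `τ² → +∞`, when `a₁` is bounded and `κ > 0`: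
here for `τ → +∞`. -/
theorem gaussFactor_mul_tendsto_zero_atTop {κ M : ℝ} (hκ : 0 < κ) {a₁ : ℝ → ℝ} (hM : ∀ s, |a₁ s| ≤ M) :
    Tendsto (fun T : ℝ => Real.exp (-(κ * T ^ 2 / 2)) * a₁ T) atTop (𝓝 0) := by
  have h1 : Tendsto (fun T : ℝ => -(κ * T ^ 2 / 2)) atTop atBot := by
    have hT2 : Tendsto (fun T : ℝ => T ^ 2) atTop atTop := tendsto_pow_atTop two_ne_zero
    have h2 : Tendsto (fun T : ℝ => κ / 2 * T ^ 2) atTop atTop := hT2.const_mul_atTop (by positivity)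
    exact (tendsto_neg_atTop_atBot.comp h2).congr fun T => by simp only [Function.comp_apply]; ring
  have hexp : Tendsto (fun T : ℝ => Real.exp (-(κ * T ^ 2 / 2))) atTop (𝓝 0) := Real.tendsto_exp_atBot.comp h1
  have hM0 : 0 ≤ M := (abs_nonneg _).trans (hM 0)
  rw [Metric.tendsto_nhds] at hexp ⊢
  intro ε hε
  filter_upwards [hexp (ε / (M + 1)) (by positivity)] with T hT
  rw [Real.dist_eq, sub_zero] at hT ⊢
  rw [abs_mul]
  calc |Real.exp (-(κ * T ^ 2 / 2))| * |a₁ T| ≤ |Real.exp (-(κ * T ^ 2 / 2))| * M :=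
        mul_le_mul_of_nonneg_left (hM T) (abs_nonneg _)
    _ < ε / (M + 1) * (M + 1) := by
        apply mul_lt_mul' hT.le (by linarith) hM0
        positivity
    _ = ε := by field_simp

/-- The same for `τ → −∞`. -/
theorem gaussFactor_mul_tendsto_zero_atBot {κ M : ℝ} (hκ : 0 < κ) {a₁ : ℝ → ℝ} (hM : ∀ s, |a₁ s| ≤ M) :
    Tendsto (fun T : ℝ => Real.exp (-(κ * T ^ 2 / 2)) * a₁ T) atBot (𝓝 0) := by
  have h := gaussFactor_mul_tendsto_zero_atTop hκ (a₁ := fun s => a₁ (-s)) (fun s => hM (-s))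
  have h2 := h.comp tendsto_neg_atBot_atTop
  refine h2.congr fun T => ?_
  simp only [Function.comp_apply, neg_neg, even_two.neg_pow]

/-- **Axial solvability on an interval**: under `a₁′ = a₂`, `a₂ = κ s a₁ − f` on `[σ, T]` with `f` continuous there,
`∫_σ^T e^{−κs²/2} f(s) ds = e^{−κσ²/2} a₁(σ) − e^{−κT²/2} a₁(T)`. -/
theorem axial_solvability_interval {κ σ T : ℝ} (hσT : σ ≤ T) {a₁ a₂ f : ℝ → ℝ}
    (h₂ : ∀ s ∈ Icc σ T, HasDerivAt a₁ (a₂ s) s) (hode : ∀ s ∈ Icc σ T, a₂ s = κ * s * a₁ s - f s)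
    (hf : ContinuousOn f (Icc σ T)) :
    ∫ s in σ..T, Real.exp (-(κ * s ^ 2 / 2)) * f s =
      Real.exp (-(κ * σ ^ 2 / 2)) * a₁ σ - Real.exp (-(κ * T ^ 2 / 2)) * a₁ T := by
  have h := axial_deriv_repr hσT h₂ hode hf
  linarith

/-- **THE AXIAL SOLVABILITY CONDITION.**  Let `0 < κ` and on the whole axis: `a₁′ = a₂`, `a₂ = κ s a₁ − f` (`−a″ + κ s a′ = f` with `a′ = a₁`),
`f` continuous with `|f| ≤ F`, and the slope `a₁` BOUNDED (`|a₁| ≤ M`).  Then `s ↦ e^{−κs²/2} f(s)` is integrable and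
`∫ e^{−κs²/2} f(s) ds = 0` over `ℝ`: the Gaussian-weighted mean of the forcing vanishes.  Equivalently, a forcing with non-zero Gaussian mean has NO
solution with bounded slope (every solution carries the homogeneous branch `a′ ∝ e^{κτ²/2}` on one side). -/
theorem axial_solvability {κ F M : ℝ} (hκ : 0 < κ) {a₁ a₂ f : ℝ → ℝ}
    (h₂ : ∀ s, HasDerivAt a₁ (a₂ s) s) (hode : ∀ s, a₂ s = κ * s * a₁ s - f s)
    (hf : Continuous f) (hF : ∀ s, |f s| ≤ F) (hM : ∀ s, |a₁ s| ≤ M) :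
    Integrable (fun s : ℝ => Real.exp (-(κ * s ^ 2 / 2)) * f s) ∧
      ∫ s, Real.exp (-(κ * s ^ 2 / 2)) * f s = 0 := by
  -- integrability: bounded `f` times the integrable Gaussian
  have hgauss : Integrable (fun s : ℝ => Real.exp (-(κ * s ^ 2 / 2))) := by
    have h := integrable_exp_neg_mul_sq (b := κ / 2) (by positivity)
    refine h.congr (Eventually.of_forall fun s => ?_)
    simp only; congr 1; ring
  have hint : Integrable (fun s : ℝ => Real.exp (-(κ * s ^ 2 / 2)) * f s) := by
    refine (hgauss.norm.mul_const F).mono' ((by fun_prop : Continuous fun s : ℝ => Real.exp (-(κ * s ^ 2 / 2))).mul hf).aestronglyMeasurable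
      (Eventually.of_forall fun s => ?_)
    rw [norm_mul, Real.norm_eq_abs, Real.norm_eq_abs]
    exact mul_le_mul_of_nonneg_left (hF s) (abs_nonneg _)
  refine ⟨hint, ?_⟩
  -- the interval integrals converge to the improper integral …
  have hlim := intervalIntegral_tendsto_integral hint tendsto_neg_atTop_atBot tendsto_id
  -- … and equal the boundary terms, which tend to `0`
  have heq : ∀ T : ℝ, 0 ≤ T → ∫ s in -T..T, Real.exp (-(κ * s ^ 2 / 2)) * f s =
      Real.exp (-(κ * (-T) ^ 2 / 2)) * a₁ (-T) - Real.exp (-(κ * T ^ 2 / 2)) * a₁ T := by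
    intro T hT
    exact axial_solvability_interval (by linarith) (fun s _ => h₂ s) (fun s _ => hode s) hf.continuousOn
  have hbdry : Tendsto (fun T : ℝ => Real.exp (-(κ * (-T) ^ 2 / 2)) * a₁ (-T) - Real.exp (-(κ * T ^ 2 / 2)) * a₁ T)
      atTop (𝓝 (0 - 0)) :=
    ((gaussFactor_mul_tendsto_zero_atBot hκ hM).comp tendsto_neg_atTop_atBot).sub (gaussFactor_mul_tendsto_zero_atTop hκ hM)
  rw [sub_zero] at hbdry
  have hlim' : Tendsto (fun T : ℝ => ∫ s in -T..T, Real.exp (-(κ * s ^ 2 / 2)) * f s) atTop (𝓝 0) :=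
    hbdry.congr' (by filter_upwards [Filter.eventually_ge_atTop (0:ℝ)] with T hT; exact (heq T hT).symm)
  exact tendsto_nhds_unique (hlim.congr fun T => by simp only [id]) hlim'

/-- **NO STEADY FLUX PROFILE WITH A ONE-SIGNED SOURCE** (corollary; LEAD memo S2B-ACCRETION-OBSTRUCTION §7).  Under the hypotheses of
`axial_solvability`, if the forcing has a sign (`f ≤ 0` everywhere, e.g. a tube that LEAKS sectional mass at every station and is fed nowhere), then
`f ≡ 0`: a bounded-slope steady flux profile tolerates no one-signed source at all — the Gaussian-weighted mean of a one-signed continuous function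
vanishes only if the function does. -/
theorem axial_noSteadyLeak {κ F M : ℝ} (hκ : 0 < κ) {a₁ a₂ f : ℝ → ℝ}
    (h₂ : ∀ s, HasDerivAt a₁ (a₂ s) s) (hode : ∀ s, a₂ s = κ * s * a₁ s - f s)
    (hf : Continuous f) (hF : ∀ s, |f s| ≤ F) (hM : ∀ s, |a₁ s| ≤ M) (hsign : ∀ s, f s ≤ 0) :
    ∀ s, f s = 0 := by
  obtain ⟨hint, hzero⟩ := axial_solvability hκ h₂ hode hf hF hM
  -- `g := −e^{−κs²/2} f ≥ 0` is continuous, integrable, with integral `0`, hence `≡ 0`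
  have hg_nonneg : ∀ s, 0 ≤ -(Real.exp (-(κ * s ^ 2 / 2)) * f s) := fun s => by
    have h1 : Real.exp (-(κ * s ^ 2 / 2)) * f s ≤ 0 := mul_nonpos_of_nonneg_of_nonpos (Real.exp_pos _).le (hsign s)
    linarith
  have hg_int : ∫ s, -(Real.exp (-(κ * s ^ 2 / 2)) * f s) = 0 := by rw [MeasureTheory.integral_neg, hzero, neg_zero]
  have hg_cont : Continuous fun s : ℝ => -(Real.exp (-(κ * s ^ 2 / 2)) * f s) := ((by fun_prop : Continuous fun s : ℝ =>
    Real.exp (-(κ * s ^ 2 / 2))).mul hf).neg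
  have hae : (fun s : ℝ => -(Real.exp (-(κ * s ^ 2 / 2)) * f s)) =ᵐ[volume] 0 :=
    (integral_eq_zero_iff_of_nonneg (fun s => hg_nonneg s) hint.neg).mp hg_int
  have heq : (fun s : ℝ => -(Real.exp (-(κ * s ^ 2 / 2)) * f s)) = 0 :=
    (hg_cont.ae_eq_iff_eq volume continuous_const).mp hae
  intro s
  have hs := congrFun heq s
  simp only [Pi.zero_apply, neg_eq_zero, mul_eq_zero] at hs
  exact hs.resolve_left (Real.exp_pos _).ne'

/-! ## The same for a GENERAL outward axial velocity `w(τ)` (the actual tube: `w_j(c_j) = 0`, `w_j` away from the waist on both sides)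

The adjoint zero mode of `T_w = −∂_τ² + w ∂_τ` is `φ = exp(−∫w)`, i.e. ANY positive `φ` with `φ′ = −wφ`; the flux identity needs no regularity of `w` at
all (it cancels), only `φ′ = −wφ` and the equation `a₁′ = w a₁ − f`. -/

/-- **Flux identity for general `w`**: if `φ′ = −wφ`, `a₁′ = a₂`, `a₂ = w a₁ − f` on `[σ, T]` with `φ, f` continuous there, then
`∫_σ^T φ f = φ(σ) a₁(σ) − φ(T) a₁(T)` — `(φ a₁)′ = −φ f`. -/
theorem axial_flux_identity {σ T : ℝ} (hσT : σ ≤ T) {w φ a₁ a₂ f : ℝ → ℝ}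
    (hφ : ∀ s ∈ Icc σ T, HasDerivAt φ (-(w s * φ s)) s) (h₂ : ∀ s ∈ Icc σ T, HasDerivAt a₁ (a₂ s) s)
    (hode : ∀ s ∈ Icc σ T, a₂ s = w s * a₁ s - f s) (hφc : ContinuousOn φ (Icc σ T)) (hf : ContinuousOn f (Icc σ T)) :
    ∫ s in σ..T, φ s * f s = φ σ * a₁ σ - φ T * a₁ T := by
  have hderiv : ∀ s ∈ uIcc σ T, HasDerivAt (fun s => φ s * a₁ s) (-(φ s * f s)) s := by
    intro s hs
    rw [uIcc_of_le hσT] at hs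
    exact ((hφ s hs).mul (h₂ s hs)).congr_deriv (by rw [hode s hs]; ring)
  have hcont : ContinuousOn (fun s => -(φ s * f s)) (uIcc σ T) := by
    rw [uIcc_of_le hσT]; exact (hφc.mul hf).neg
  have h := integral_eq_sub_of_hasDerivAt hderiv hcont.intervalIntegrable
  rw [intervalIntegral.integral_neg] at h
  linarith

/-- **THE AXIAL SOLVABILITY CONDITION, general `w`.**  On the whole axis let `φ′ = −wφ`, `a₁′ = a₂ = w a₁ − f`, `φ` and `f` continuous, `φ f` integrable,
and let the flux boundary terms die: `φ(τ) a₁(τ) → 0` as `τ → ±∞` (e.g. `a₁` bounded and `φ → 0`, `axial_solvability_general_of_bounded`).  Then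
`∫ φ f = 0` over `ℝ`.  For a tube whose axial velocity `w` vanishes only at the waist and points away from it, `φ = exp(−∫_{c}^τ w)` is such a weight: the
`φ`-weighted net flux input must vanish for a bounded-slope steady flux profile to exist (memo S2B-ACCRETION-OBSTRUCTION §2.2). -/
theorem axial_solvability_general {w φ a₁ a₂ f : ℝ → ℝ}
    (hφ : ∀ s, HasDerivAt φ (-(w s * φ s)) s) (h₂ : ∀ s, HasDerivAt a₁ (a₂ s) s) (hode : ∀ s, a₂ s = w s * a₁ s - f s)
    (hf : Continuous f) (hint : Integrable (fun s : ℝ => φ s * f s))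
    (hTop : Tendsto (fun T : ℝ => φ T * a₁ T) atTop (𝓝 0)) (hBot : Tendsto (fun T : ℝ => φ T * a₁ T) atBot (𝓝 0)) :
    ∫ s, φ s * f s = 0 := by
  have hφc : Continuous φ := continuous_iff_continuousAt.2 fun s => (hφ s).continuousAt
  have hlim := intervalIntegral_tendsto_integral hint tendsto_neg_atTop_atBot tendsto_id
  have heq : ∀ T : ℝ, 0 ≤ T → ∫ s in -T..T, φ s * f s = φ (-T) * a₁ (-T) - φ T * a₁ T := fun T hT =>
    axial_flux_identity (by linarith) (fun s _ => hφ s) (fun s _ => h₂ s) (fun s _ => hode s) hφc.continuousOn hf.continuousOn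
  have hbdry : Tendsto (fun T : ℝ => φ (-T) * a₁ (-T) - φ T * a₁ T) atTop (𝓝 (0 - 0)) :=
    (hBot.comp tendsto_neg_atTop_atBot).sub hTop
  rw [sub_zero] at hbdry
  have hlim' : Tendsto (fun T : ℝ => ∫ s in -T..T, φ s * f s) atTop (𝓝 0) :=
    hbdry.congr' (by filter_upwards [Filter.eventually_ge_atTop (0:ℝ)] with T hT; exact (heq T hT).symm)
  exact tendsto_nhds_unique (hlim.congr fun T => by simp only [id]) hlim'

/-- The boundary terms die when `a₁` is bounded and the weight tends to `0` at both ends. -/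
theorem axial_solvability_general_of_bounded {w φ a₁ a₂ f : ℝ → ℝ} {M : ℝ}
    (hφ : ∀ s, HasDerivAt φ (-(w s * φ s)) s) (h₂ : ∀ s, HasDerivAt a₁ (a₂ s) s) (hode : ∀ s, a₂ s = w s * a₁ s - f s)
    (hf : Continuous f) (hint : Integrable (fun s : ℝ => φ s * f s)) (hM : ∀ s, |a₁ s| ≤ M)
    (hφTop : Tendsto φ atTop (𝓝 0)) (hφBot : Tendsto φ atBot (𝓝 0)) :
    ∫ s, φ s * f s = 0 := by
  have hM0 : 0 ≤ M := (abs_nonneg _).trans (hM 0)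
  have key : ∀ {l : Filter ℝ}, Tendsto φ l (𝓝 0) → Tendsto (fun T => φ T * a₁ T) l (𝓝 0) := by
    intro l hl
    rw [Metric.tendsto_nhds] at hl ⊢
    intro ε hε
    filter_upwards [hl (ε / (M + 1)) (by positivity)] with T hT
    rw [Real.dist_eq, sub_zero] at hT ⊢
    rw [abs_mul]
    calc |φ T| * |a₁ T| ≤ |φ T| * M := mul_le_mul_of_nonneg_left (hM T) (abs_nonneg _)
      _ < ε / (M + 1) * (M + 1) := by
          apply mul_lt_mul' hT.le (by linarith) hM0
          positivity
      _ = ε := by field_simp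
  exact axial_solvability_general hφ h₂ hode hf hint (key hφTop) (key hφBot)

/-- **No steady one-signed leak, general `w`**: with a POSITIVE weight `φ` as above, a one-signed continuous source (`f ≤ 0`) with `∫ φ f = 0` vanishes
identically. -/
theorem axial_noSteadyLeak_general {φ f : ℝ → ℝ} (hφc : Continuous φ) (hφpos : ∀ s, 0 < φ s) (hf : Continuous f)
    (hint : Integrable (fun s : ℝ => φ s * f s)) (hzero : ∫ s, φ s * f s = 0) (hsign : ∀ s, f s ≤ 0) : ∀ s, f s = 0 := by
  have hg_nonneg : ∀ s, 0 ≤ -(φ s * f s) := fun s => by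
    have h1 : φ s * f s ≤ 0 := mul_nonpos_of_nonneg_of_nonpos (hφpos s).le (hsign s)
    linarith
  have hg_int : ∫ s, -(φ s * f s) = 0 := by rw [MeasureTheory.integral_neg, hzero, neg_zero]
  have hae : (fun s : ℝ => -(φ s * f s)) =ᵐ[volume] 0 :=
    (integral_eq_zero_iff_of_nonneg (fun s => hg_nonneg s) hint.neg).mp hg_int
  have heq : (fun s : ℝ => -(φ s * f s)) = 0 := ((hφc.mul hf).neg.ae_eq_iff_eq volume continuous_const).mp hae
  intro s
  have hs := congrFun heq s
  simp only [Pi.zero_apply, neg_eq_zero, mul_eq_zero] at hs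
  exact hs.resolve_left (hφpos s).ne'

end Summit.NavierStokesRegularity.NavierStokesRegularity.Theorems.DefectColumnGate

end
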